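import Literature.NumberTheory.EllipticCurves.ZpExtensionEisensteinOrdinaryTorsionCutReadoutProofs
import Literature.NumberTheory.EllipticCurves.ZpExtensionEisensteinDVRSettingH5bTorsionCutClauseProofs
import Literature.NumberTheory.EllipticCurves.ZpExtensionEisensteinPiTorsionCutH2OfBasisProofs
import Literature.NumberTheory.EllipticCurves.LocalKernelOfReductionDivisibleThreeProofs
import Literature.NumberTheory.EllipticCurves.TorsionFilAtCountMultiplicativeThreeProofs
import HarnessLib

/-!
# Howard's H.5(b) at tower level `0` and the places `v ∣ 3` of MULTIPLICATIVE reduction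
# (theorems only — no definition, no named fact, no instance, no `sorry`)

Topic `NumberTheory/EllipticCurves` (LEAD `bsd-wall-utd-p1`, crux r205 stmt-BirchSwinnertonDyer-24737
`TwinAlgMuZeroAtThree`, line `beta-road`, stub `stub_howardOutputsOfFamily`, E2 unit at `v ∣ 3`).  Cell x9's
`ZpExtensionEisensteinSelmerH5bOrdinaryAnomalousProofs` proves the H.5(b) transport identity
`(θ_v ∘ transport_v)(F̄_𝔮(σ v)) = F̄_𝔮(v)` at tower level `0` for the curve's Eisenstein DVR setting at places `v ∋ p` of GOOD
reduction with an ordinary point (anomalous places included); its proof uses the reduction type only through the two local data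
`hFsurj` (`×p : Fil_w E[p^{k+1}] → Fil_w E[p^k]` onto) and `hbasis` (a basis of `E[p^k]` adapted to `Fil_w`).  At `p = 3` both data
are now available at places of MULTIPLICATIVE reduction (`LocalKernelOfReductionDivisibleThreeProofs`,
`TorsionFilAtCountMultiplicativeThreeProofs`), so the same two theorems hold there — this file, whose proofs are x9's with the two
`have`s replaced (the twin `W′` of the universal-toric-descent route has multiplicative reduction at `3 ∥ N′`):

* `propagate_eisensteinTowerTriple_zero_eq_map_torsionCut_of_hasMultiplicativeReductionAt_three` — the torsion-cut readout of
  `F̄_𝔮(w)` at a multiplicative `w ∋ 3`;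
* `eisensteinDVRSetting_h5b_clause_zero_of_mem_three_of_hasMultiplicativeReductionAt` — H.5(b) at level `0` at `v, σ v ∋ 3`
  multiplicative.
No summit statement is proved; BSD is not proved by any of this.

References: [Howard2004HeegnerKolyvagin] §1.3 H.5(b), Def. 3.1.2, §3.1–3.2, Lemma 3.2.7; [GreenbergLNM1716] §2;
[MazurTateTeitelbaum1986Invent] Ch. I §17; [SerreGaloisCohomology1997] I §2.4, II §5.2.
-/

set_option autoImplicit false

noncomputable section

open Function NumberField IsDedekindDomain Field
open scoped NumberField TensorProduct ContRepresentation

namespace WeierstrassCurve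

open Literature.NumberTheory.EllipticCurves Literature.NumberTheory.GaloisRepresentations
open Literature.NumberTheory.GaloisRepresentations.DiscreteGaloisModule
open Literature.NumberTheory.GaloisCohomology.Howard2004
open Literature.NumberTheory.EllipticCurves.IwasawaAlgebra Literature.NumberTheory.EllipticCurves.ZpExtension

variable {K : Type} [Field K] [NumberField K] (W : WeierstrassCurve ℚ) [W.IsElliptic]
  (κ : ZpExtension K 3) {m : ℕ} (hm : 1 ≤ m)
  (S : Finset (HeightOneSpectrum (𝓞 K)))
  (hpS : ∀ v : HeightOneSpectrum (𝓞 K), ((3 : ℕ) : 𝓞 K) ∈ v.asIdeal → v ∈ S)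
  (hbad : ∀ v : HeightOneSpectrum (𝓞 K), v ∉ S → ((3 : ℕ) : 𝓞 K) ∉ v.asIdeal → (W.baseChange K).HasGoodReductionAt v)
  (L : Set (HeightOneSpectrum (𝓞 K)))
  (hL : letI := IwasawaAlgebra.isLocalRing_quotient_X_pow_add_C 3 hm
    L ⊆ (W.eisensteinTower κ hm).degreeTwoPrimes 3)
  (hLS : ∀ v ∈ L, v ∉ S)
  (jbar : AlgebraicClosure K →+* ℂ)
  (σ : K ≃ₐ[ℚ] K) (hσ₁ : σ ≠ 1) (hσ : σ * σ = 1) (τ : AlgebraicClosure K ≃+* AlgebraicClosure K)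
  (hτ : IsLiftOfAut σ τ) (hτ₂ : Function.Involutive τ)
  (D : letI := IwasawaAlgebra.isLocalRing_quotient_X_pow_add_C 3 hm
    ∀ k, DualityDatum 3 (ConjugationDatum.ofLifts σ hσ₁ hσ τ hτ hτ₂) ((W.eisensteinTower κ hm).ρ k)
      (IwasawaAlgebra.EisensteinCoeff 3 m (k + 1)))
  (fs : letI := IwasawaAlgebra.isLocalRing_quotient_X_pow_add_C 3 hm
    ∀ (k : ℕ) (n : Finset (HeightOneSpectrum (𝓞 K))) (v : HeightOneSpectrum (𝓞 K)),
      galoisCohomology ((W.eisensteinLevelQuot κ hm k n).toLocal (Sum.inr v)) 1 →+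
        SingularQuotient (GaloisRep.toLocal v (W.eisensteinLevelQuot κ hm k n)) ⊗[ℤ] Gell v)

/-- **The torsion-cut readout for the curve's Eisenstein DVR setting at tower level `0` and a place `w ∋ 3` of MULTIPLICATIVE
reduction**, for an element `g₀ ∈ Γ_{K_w}` with `κ(g₀) = 3^s` and `5·3^s + 1 ≤ m`:
`F̄_𝔮(w) = π̄_* {y ∈ H¹(K_w, W₁) : [T]^{2·3^s} y ∈ H¹_str(K_w, Fil_w W₁)}` (x9's `propagate_eisensteinTowerTriple_zero_eq_map_torsionCut`
with the local data `hFsurj`/`hbasis` supplied at a multiplicative place).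
[cite: Howard2004HeegnerKolyvagin, §1.3 H.5(b), Def. 3.1.2, §3.1 and Lemma 3.2.7 (arXiv:1202.6340 p. 7 L96–97, p. 15 L99–108, p. 16 L142–160)]
[cite: GreenbergLNM1716, §2] -/
theorem propagate_eisensteinTowerTriple_zero_eq_map_torsionCut_of_hasMultiplicativeReductionAt_three
    {w : HeightOneSpectrum (𝓞 K)} (hpw : ((3 : ℕ) : 𝓞 K) ∈ w.asIdeal) (hmult : (W.baseChange K).HasMultiplicativeReductionAt w)
    {g₀ : absoluteGaloisGroup (w.adicCompletion K)} {s : ℕ}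
    (hg₀ : (κ (absGaloisRestrict K (w.adicCompletion K) g₀)).toAdd = ((3 ^ s : ℕ) : ℤ_[3])) (hms : 5 * 3 ^ s + 1 ≤ m) :
    letI := IwasawaAlgebra.isDomain_quotient_X_pow_add_C 3 hm
    letI := IwasawaAlgebra.isDiscreteValuationRing_quotient_X_pow_add_C 3 hm
    haveI := IwasawaAlgebra.EisensteinCoeff.isLocalRing_succ 3 hm
    letI := IwasawaAlgebra.EisensteinCoeff.algebraOfSpecSucc 3 m
    haveI := W.isScalarTower_algebraOfSpecSucc (K := K) (p := 3) (m := m)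
    letI := W.residueModuleSucc (K := K) (p := 3) hm
    ((W.isQuotientBy_eisensteinDVRSetting_πbar κ hm S hpS hbad L hL hLS jbar
        (ConjugationDatum.ofLifts σ hσ₁ hσ τ hτ hτ₂) D fs 0).propagateStructure
      (W.eisensteinTowerTriple κ hm S hpS hbad L hL hLS 0).cond) (Sum.inr w) =
    ((((κ.eisensteinTwist ((W.baseChange K).torsionGaloisModule (((3 : ℕ) : ℤ) ^ 1)) hm 1).toLocal (Sum.inr w)).strictSubgroup
        (((W.baseChange K).ordinaryFiltrationAt w (fun j ↦ (W.baseChange K).torsionGaloisModuleReduce 3 j)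
          (fun _ _ ↦ rfl)).twistedFil (p := 3) (m := m) 1)
        (fun g _ hx ↦ ((W.baseChange K).ordinaryFiltrationAt w (fun j ↦ (W.baseChange K).torsionGaloisModuleReduce 3 j)
          (fun _ _ ↦ rfl)).twistedFil_le_comap hm 1 g hx)).comap
      (galoisCohomology.scalarMapH1 _
        ((κ.isScalarLinear_eisensteinTwist ((W.baseChange K).torsionGaloisModule (((3 : ℕ) : ℤ) ^ 1)) hm 1).restrictField _)
        ((Ideal.Quotient.mk _ PowerSeries.X : EisensteinCoeff 3 m 1) ^ (2 * 3 ^ s)))).map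
      ((W.isQuotientBy_eisensteinDVRSetting_πbar κ hm S hpS hbad L hL hLS jbar
        (ConjugationDatum.ofLifts σ hσ₁ hσ τ hτ hτ₂) D fs 0).localCohomologyMap (Sum.inr w) 1) := by
  letI := IwasawaAlgebra.isDomain_quotient_X_pow_add_C 3 hm
  letI := IwasawaAlgebra.isDiscreteValuationRing_quotient_X_pow_add_C 3 hm
  haveI := IwasawaAlgebra.EisensteinCoeff.isLocalRing_succ 3 hm
  letI := IwasawaAlgebra.EisensteinCoeff.algebraOfSpecSucc 3 m
  haveI := W.isScalarTower_algebraOfSpecSucc (K := K) (p := 3) (m := m)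
  letI := W.residueModuleSucc (K := K) (p := 3) hm
  -- the two local inputs at the MULTIPLICATIVE place `w ∋ 3` (the only change w.r.t. x9's good-ordinary file)
  have hFsurj : ∀ (k : ℕ) (y : geomTorsion (W.baseChange K) (((3 : ℕ) : ℤ) ^ k)),
      y ∈ ((W.baseChange K).ordinaryFiltrationAt w (fun j ↦ (W.baseChange K).torsionGaloisModuleReduce 3 j)
        (fun _ _ ↦ rfl)).fil k →
      ∃ y' ∈ ((W.baseChange K).ordinaryFiltrationAt w (fun j ↦ (W.baseChange K).torsionGaloisModuleReduce 3 j)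
        (fun _ _ ↦ rfl)).fil (k + 1), (W.baseChange K).torsionGaloisModuleReduce 3 k y' = y := fun k y hy ↦
    (W.baseChange K).exists_mem_torsionFilAt_reduce_eq_of_hasMultiplicativeReductionAt_three w hpw hmult
      (fun j ↦ (W.baseChange K).torsionGaloisModuleReduce 3 j) (fun _ _ ↦ rfl) k y hy
  have hbasis : ∀ k, 1 ≤ k → ∃ e : geomTorsion (W.baseChange K) (((3 : ℕ) : ℤ) ^ k) ≃+ (Fin 2 → ZMod (3 ^ k)),
      ∀ x, x ∈ ((W.baseChange K).ordinaryFiltrationAt w (fun j ↦ (W.baseChange K).torsionGaloisModuleReduce 3 j)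
        (fun _ _ ↦ rfl)).fil k ↔ e x 1 = 0 := fun k hk ↦
    (W.baseChange K).exists_addEquiv_mem_torsionFilAt_iff_of_hasMultiplicativeReductionAt_three w hpw hmult hk
  have hms1 : 3 ^ s < m := by omega
  obtain ⟨t, ht⟩ := (W.baseChange K).exists_piFil_subPowFamily_apply κ hm w
    ((W.baseChange K).ordinaryFiltrationAt w (fun j ↦ (W.baseChange K).torsionGaloisModuleReduce 3 j) (fun _ _ ↦ rfl))
    (3 ^ s)
  exact (W.baseChange K).propagate_eisensteinSelmerStructure_eq_map_torsionCut κ hm S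
    (fun v _ ↦ (W.baseChange K).ordinaryFiltrationAt v (fun j ↦ (W.baseChange K).torsionGaloisModuleReduce 3 j)
      (fun _ _ ↦ rfl))
    w hpw _ (W.isQuotientBy_eisensteinDVRSetting_πbar κ hm S hpS hbad L hL hLS jbar
      (ConjugationDatum.ofLifts σ hσ₁ hσ τ hτ hτ₂) D fs 0)
    hFsurj hbasis hg₀ (by omega) t (3 ^ s) ht
    (fun j z ↦ (W.baseChange K).piTorsionCut_hH2Fil_of_basis κ hm w _ hbasis hg₀ hms1 j (t j) (ht j) z)
    (fun j z ↦ (W.baseChange K).piTorsionCut_hH2_of_basis κ hm w _ hbasis hg₀ hms1 j z)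
    (by omega)

/-- **H.5(b), bottom level, at `v ∈ S` above `3`, places of MULTIPLICATIVE reduction** (the `hfin` clause of
`eisensteinDVRSetting_h5b_of` at `k = 0`, conjugation datum `ConjugationDatum.ofLifts σ …`): if `3 ∈ v`, `3 ∈ σ v`, at `w = v` and
`w = σ v` the curve has multiplicative reduction, `κ` is anticyclotomic for the conjugation, and elements `g_w ∈ Γ_{K_w}` with
`κ(g_w) = 3^{s_w}` and `5·3^{s_w} + 1 ≤ m` are given, then `(θ_v ∘ transport_v)(F̄_𝔮(σ v)) = F̄_𝔮(v)` at tower level `0` (x9's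
`eisensteinDVRSetting_h5b_clause_zero_of_mem_p`, multiplicative places).
[cite: Howard2004HeegnerKolyvagin, §1.3 H.5(b), Def. 3.1.2, §3.1–3.2 and Lemma 3.2.7 (arXiv:1202.6340 p. 7 L93–97 and L108–113, p. 15 L99–108, p. 16 L5–6, L116–123 and L142–160)]
[cite: GreenbergLNM1716, §2] [cite: MazurTateTeitelbaum1986Invent, Ch. I §17] [cite: SerreGaloisCohomology1997, I §2.4 and II §5.2] -/
theorem eisensteinDVRSetting_h5b_clause_zero_of_mem_three_of_hasMultiplicativeReductionAt {v : HeightOneSpectrum (𝓞 K)}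
    (hpv : ((3 : ℕ) : 𝓞 K) ∈ v.asIdeal)
    (hpσv : ((3 : ℕ) : 𝓞 K) ∈ ((ConjugationDatum.ofLifts σ hσ₁ hσ τ hτ hτ₂).σ • v).asIdeal)
    (hmult : ∀ w ∈ ({v, (ConjugationDatum.ofLifts σ hσ₁ hσ τ hτ hτ₂).σ • v} : Set (HeightOneSpectrum (𝓞 K))),
      (W.baseChange K).HasMultiplicativeReductionAt w)
    (hanti : ∀ g : absoluteGaloisGroup K,
      (κ ((ConjugationDatum.ofLifts σ hσ₁ hσ τ hτ hτ₂).conj g)).toAdd = -(κ g).toAdd)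
    {s : HeightOneSpectrum (𝓞 K) → ℕ} {g : ∀ w : HeightOneSpectrum (𝓞 K), absoluteGaloisGroup (w.adicCompletion K)}
    (hg : ∀ w ∈ ({v, (ConjugationDatum.ofLifts σ hσ₁ hσ τ hτ hτ₂).σ • v} : Set (HeightOneSpectrum (𝓞 K))),
      (κ (absGaloisRestrict K (w.adicCompletion K) (g w))).toAdd = ((3 ^ s w : ℕ) : ℤ_[3]))
    (hms : ∀ w ∈ ({v, (ConjugationDatum.ofLifts σ hσ₁ hσ τ hτ hτ₂).σ • v} : Set (HeightOneSpectrum (𝓞 K))),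
      5 * 3 ^ s w + 1 ≤ m) :
    letI := IwasawaAlgebra.isDomain_quotient_X_pow_add_C 3 hm
    letI := IwasawaAlgebra.isDiscreteValuationRing_quotient_X_pow_add_C 3 hm
    haveI := IwasawaAlgebra.EisensteinCoeff.isLocalRing_succ 3 hm
    letI := IwasawaAlgebra.EisensteinCoeff.algebraOfSpecSucc 3 m
    haveI := W.isScalarTower_algebraOfSpecSucc (K := K) (p := 3) (m := m)
    letI := W.residueModuleSucc (K := K) (p := 3) hm
    AddSubgroup.map
        (((W.residualTauGeomTorsion (p := 3) (ConjugationDatum.ofLifts σ hσ₁ hσ τ hτ hτ₂) hm (k := 0 + 1)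
            (Nat.succ_pos 0)).thetaH1 (Sum.inr v)).comp
          ((ConjugationDatum.ofLifts σ hσ₁ hσ τ hτ hτ₂).transportH1 ((W.baseChange K).torsionGaloisModule ((3 : ℕ) : ℤ)) v))
        (((W.isQuotientBy_eisensteinDVRSetting_πbar κ hm S hpS hbad L hL hLS jbar
            (ConjugationDatum.ofLifts σ hσ₁ hσ τ hτ hτ₂) D fs 0).propagateStructure
          (W.eisensteinTowerTriple κ hm S hpS hbad L hL hLS 0).cond)
          (Sum.inr ((ConjugationDatum.ofLifts σ hσ₁ hσ τ hτ hτ₂).σ • v))) =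
      ((W.isQuotientBy_eisensteinDVRSetting_πbar κ hm S hpS hbad L hL hLS jbar
          (ConjugationDatum.ofLifts σ hσ₁ hσ τ hτ hτ₂) D fs 0).propagateStructure
        (W.eisensteinTowerTriple κ hm S hpS hbad L hL hLS 0).cond) (Sum.inr v) := by
  -- `p ∈ w` for both places
  have hpw : ∀ w ∈ ({v, (ConjugationDatum.ofLifts σ hσ₁ hσ τ hτ hτ₂).σ • v} : Set (HeightOneSpectrum (𝓞 K))),
      ((3 : ℕ) : 𝓞 K) ∈ w.asIdeal := by
    intro w hw
    rcases hw with rfl | hw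
    · exact hpv
    · rw [Set.mem_singleton_iff] at hw
      rw [hw]
      exact hpσv
  -- ONE exponent `S' = max (s v) (s σv)` at both places, realised by `g_w ^ p^(S' - s w)`
  have hle : ∀ w ∈ ({v, (ConjugationDatum.ofLifts σ hσ₁ hσ τ hτ hτ₂).σ • v} : Set (HeightOneSpectrum (𝓞 K))),
      s w ≤ max (s v) (s ((ConjugationDatum.ofLifts σ hσ₁ hσ τ hτ hτ₂).σ • v)) := by
    intro w hw
    rcases hw with rfl | hw
    · exact le_max_left _ _
    · rw [Set.mem_singleton_iff] at hw
      rw [hw]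
      exact le_max_right _ _
  have hmS : 5 * 3 ^ max (s v) (s ((ConjugationDatum.ofLifts σ hσ₁ hσ τ hτ hτ₂).σ • v)) + 1 ≤ m := by
    rcases le_total (s v) (s ((ConjugationDatum.ofLifts σ hσ₁ hσ τ hτ hτ₂).σ • v)) with h | h
    · rw [max_eq_right h]; exact hms _ (by simp)
    · rw [max_eq_left h]; exact hms _ (by simp)
  have hg' : ∀ w ∈ ({v, (ConjugationDatum.ofLifts σ hσ₁ hσ τ hτ hτ₂).σ • v} : Set (HeightOneSpectrum (𝓞 K))),
      (κ (absGaloisRestrict K (w.adicCompletion K)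
        (g w ^ 3 ^ (max (s v) (s ((ConjugationDatum.ofLifts σ hσ₁ hσ τ hτ hτ₂).σ • v)) - s w)))).toAdd =
        ((3 ^ max (s v) (s ((ConjugationDatum.ofLifts σ hσ₁ hσ τ hτ hτ₂).σ • v)) : ℕ) : ℤ_[3]) := by
    intro w hw
    rw [map_pow, map_pow, toAdd_pow, hg w hw, nsmul_eq_mul, ← Nat.cast_mul, ← pow_add, Nat.sub_add_cancel (hle w hw)]
  exact W.eisensteinDVRSetting_h5b_clause_zero_of_torsionCut_readout κ hm S hpS hbad L hL hLS jbar σ hσ₁ hσ τ hτ hτ₂ D fs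
    hanti (fun w hw ↦ W.propagate_eisensteinTowerTriple_zero_eq_map_torsionCut_of_hasMultiplicativeReductionAt_three κ hm S
      hpS hbad L hL hLS jbar σ hσ₁ hσ τ hτ hτ₂ D fs (hpw w hw) (hmult w hw) (hg' w hw) hmS)

end WeierstrassCurve

end
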